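import Summits.Ventures.CertifiedArithmetic.LowPrec.GemmEnvelopeAssembled

/-!
# GEMM-level envelopes, part (i): output rounding `γ_out` (pub-lowprec gemm gen 22, LXX-i)

HONEST FRAMING: certified error envelopes and provably optimal rounding/accumulation schemes for
low-precision formats under stated cost models; every table by two implementations; no hardware or
vendor claims.

E-DEC (`GemmEnvelopeDecomposition.eDec_blocked`) carries the output-rounding constant `δ` symbolically; the
assembled theorems of `GemmEnvelopeAssembled` take the `binary32` accumulator as the result (`δ = 0`).  This
file supplies `γ_out`: if the accumulated result `acc` is rounded to nearest into an OUTPUT FORMAT `φ` inside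
`φ`'s normal range, then `δ = u_φ/(1+u_φ)` (the sharp relative unit, `EnvelopeStructural.abs_sub_roundNE_le_sharp`)
and the GEMM envelope becomes `35/289 + γ·324/289 + u_φ/(1+u_φ)·(324/289)·(1+γ)` — for `bfloat16` output
`u/(1+u) = 1/257` (`BFloat16_sharp_unit`), i.e. an additive `≈ 4.4·10⁻³` on top of `35/289 ≈ 0.1211`; for a
`binary32` output the term is `1/16777217·(324/289)·(1+γ)`.  THEOREMS: `gemm_mxCeil_E4M3_output`,
`gemm_vec_E4M3_output` (generic accumulation constant `γ`, any output format), and the end-to-end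
`gemm_mxCeil_E4M3_twoLevel_Binary32_outBFloat16` (MX-E4M3 operands on `C_blk(κ)`, `κ ≤ 14336`, two-level
`binary32` accumulation inside/across the `B` blocks of length `≤ k`, result rounded to `bfloat16`).
Output rounding is the same additive term for every operand configuration, so it never changes a
decision-table verdict between operand datapaths (rows P2–P7); it only matters when OUTPUT formats differ.
[cite: BlanchardHighamLopezMaryPranesh2020, §3]; [cite: RouhaniEtAl2023MX, §5.1]; [cite: MicikeviciusEtAl2022, §3]
-/

namespace Summit.Ventures.CertifiedArithmetic.LowPrec.GemmEnvelope

open Finset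
open Literature.ComputerArithmetic.FloatingPoint
open Literature.ComputerArithmetic.FloatingPoint.Format
open Literature.ComputerArithmetic.FloatingPoint.MiniFloat
open Literature.ComputerArithmetic.FloatingPoint.MXBlock
open Literature.ComputerArithmetic.JeannerodRump2018
open Literature.ComputerArithmetic.JeannerodRump2018.SumTree
open Summit.Ventures.CertifiedArithmetic.LowPrec.SR

/-- `bfloat16`: `u/(1+u) = 1/257`. [cite: BlanchardHighamLopezMaryPranesh2020, Table 1.1] -/
theorem BFloat16_sharp_unit :
    Format.BFloat16.unitRoundoff / (1 + Format.BFloat16.unitRoundoff) = 1 / 257 := by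
  rw [Format.unitRoundoff_values.2.2.2.2.2.2.1]; norm_num

/-- **MX-E4M3 GEMM with output rounding.**  Operands on `C_blk(κ)`, `κ ≤ 14336`, ceil-scaled MX-E4M3; any
accumulation with relative constant `γ` (w.r.t. `Σ|q̂a q̂b|`); the result rounded to nearest into the output
format `φ` inside its normal range: `|fl_φ(acc) − Σ a b| ≤ (35/289 + γ·324/289 + u_φ/(1+u_φ)·324/289·(1+γ))·Σ|a b|`.
[cite: RouhaniEtAl2023MX, §5.1] -/
theorem gemm_mxCeil_E4M3_output {B k : ℕ} (a b : Fin B → Fin k → ℚ) {κ γ acc : ℚ} (hγ : 0 ≤ γ)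
    (hκ : κ ≤ 14336)
    (hca : ∀ j i, a j i = 0 ∨ blockMax (a j) ≤ κ * |a j i|)
    (hcb : ∀ j i, b j i = 0 ∨ blockMax (b j) ≤ κ * |b j i|)
    (hacc : |acc - ∑ j, ∑ i, (ceilScale E4M3 (a j) * (roundNE E4M3 (a j i / ceilScale E4M3 (a j))).toRat) *
        (ceilScale E4M3 (b j) * (roundNE E4M3 (b j i / ceilScale E4M3 (b j))).toRat)|
      ≤ γ * ∑ j, ∑ i, |(ceilScale E4M3 (a j) * (roundNE E4M3 (a j i / ceilScale E4M3 (a j))).toRat) *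
        (ceilScale E4M3 (b j) * (roundNE E4M3 (b j i / ceilScale E4M3 (b j))).toRat)|)
    (φ : Format) (hlo : 2 ^ φ.manBits * φ.quantum ≤ |acc|) (hhi : |acc| ≤ φ.maxRat) :
    |(roundNE φ acc).toRat - ∑ j, ∑ i, a j i * b j i|
      ≤ (35 / 289 + γ * (324 / 289) + φ.unitRoundoff / (1 + φ.unitRoundoff) * (324 / 289) * (1 + γ))
        * ∑ j, ∑ i, |a j i * b j i| := by
  have hδ : 0 ≤ φ.unitRoundoff / (1 + φ.unitRoundoff) := by
    have := φ.unitRoundoff_pos; positivity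
  have hc : |(roundNE φ acc).toRat - acc| ≤ φ.unitRoundoff / (1 + φ.unitRoundoff) * |acc| := by
    rw [abs_sub_comm]; exact abs_sub_roundNE_le_sharp hlo hhi
  exact gemm_mxCeil_envelope_E4M3 a b _ _ hγ hδ hκ hca hcb (fun _ _ => rfl) (fun _ _ => rfl) hacc hc

/-- **Per-vector E4M3 GEMM with output rounding.**  Operands on `C_row(κ)`, `κ ≤ 28672`, covering numerators;
any accumulation with relative constant `γ`; result rounded to nearest into `φ` inside its normal range.
[cite: MicikeviciusEtAl2022, §3] -/
theorem gemm_vec_E4M3_output {ι : Type*} [Fintype ι] (a b : ι → ℚ) {Aa Ab κ γ acc : ℚ} (hγ : 0 ≤ γ)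
    (hκ : κ ≤ 28672) (hAa : ∀ i, |a i| ≤ Aa) (hAb : ∀ i, |b i| ≤ Ab)
    (hca : ∀ i, a i = 0 ∨ Aa ≤ κ * |a i|) (hcb : ∀ i, b i = 0 ∨ Ab ≤ κ * |b i|)
    (hacc : |acc - ∑ i, (Aa / E4M3.maxRat * (roundNE E4M3 (a i / (Aa / E4M3.maxRat))).toRat) *
        (Ab / E4M3.maxRat * (roundNE E4M3 (b i / (Ab / E4M3.maxRat))).toRat)|
      ≤ γ * ∑ i, |(Aa / E4M3.maxRat * (roundNE E4M3 (a i / (Aa / E4M3.maxRat))).toRat) *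
        (Ab / E4M3.maxRat * (roundNE E4M3 (b i / (Ab / E4M3.maxRat))).toRat)|)
    (φ : Format) (hlo : 2 ^ φ.manBits * φ.quantum ≤ |acc|) (hhi : |acc| ≤ φ.maxRat) :
    |(roundNE φ acc).toRat - ∑ i, a i * b i|
      ≤ (35 / 289 + γ * (324 / 289) + φ.unitRoundoff / (1 + φ.unitRoundoff) * (324 / 289) * (1 + γ))
        * ∑ i, |a i * b i| := by
  have hδ : 0 ≤ φ.unitRoundoff / (1 + φ.unitRoundoff) := by
    have := φ.unitRoundoff_pos; positivity
  have hc : |(roundNE φ acc).toRat - acc| ≤ φ.unitRoundoff / (1 + φ.unitRoundoff) * |acc| := by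
    rw [abs_sub_comm]; exact abs_sub_roundNE_le_sharp hlo hhi
  exact gemm_vec_envelope_E4M3 a b _ _ hγ hδ hκ hAa hAb hca hcb (fun _ => rfl) (fun _ => rfl) hacc hc

/-- **MX-E4M3 GEMM, END TO END, `bfloat16` OUTPUT.**  As `gemm_mxCeil_E4M3_twoLevel_Binary32` (two-level
`binary32` accumulation, blocks of length `≤ k`, `B` blocks, all nodes in range), and the `binary32` result is
finally rounded to nearest into `bfloat16` inside its normal range:
`|fl_bf16(ŝ) − Σ a b| ≤ (35/289 + γ₂·324/289 + (1/257)·(324/289)·(1+γ₂))·Σ|a b|`,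
`γ₂ = (k−1)u' + (B−1)u'(1+(k−1)u')`, `u' = 1/16777217`.
[cite: BlanchardHighamLopezMaryPranesh2020, §3]; [cite: RouhaniEtAl2023MX, §5.1] -/
theorem gemm_mxCeil_E4M3_twoLevel_Binary32_outBFloat16 {B k : ℕ} (hB : 1 ≤ B) (hk : 1 ≤ k)
    (a b : Fin B → Fin k → ℚ) {κ : ℚ} (hκ : κ ≤ 14336)
    (hca : ∀ j i, a j i = 0 ∨ blockMax (a j) ≤ κ * |a j i|)
    (hcb : ∀ j i, b j i = 0 ∨ blockMax (b j) ≤ κ * |b j i|)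
    (ts : List SumTree) (T : SumTree)
    (hexact : (ts.map SumTree.exact).sum =
      ∑ j, ∑ i, (ceilScale E4M3 (a j) * (roundNE E4M3 (a j i / ceilScale E4M3 (a j))).toRat) *
        (ceilScale E4M3 (b j) * (roundNE E4M3 (b j i / ceilScale E4M3 (b j))).toRat))
    (habs : (ts.map absSum).sum =
      ∑ j, ∑ i, |(ceilScale E4M3 (a j) * (roundNE E4M3 (a j i / ceilScale E4M3 (a j))).toRat) *
        (ceilScale E4M3 (b j) * (roundNE E4M3 (b j i / ceilScale E4M3 (b j))).toRat)|)
    (hlen : ts.length = B)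
    (hT : T.leaves = ts.map (SumTree.eval (flα Format.Binary32)))
    (hinner : ∀ t ∈ ts, TreeInRange Format.Binary32 t) (hK : ∀ t ∈ ts, t.leaves.length ≤ k)
    (houter : TreeInRange Format.Binary32 T)
    (hlo : 2 ^ Format.BFloat16.manBits * Format.BFloat16.quantum ≤ |SumTree.eval (flα Format.Binary32) T|)
    (hhi : |SumTree.eval (flα Format.Binary32) T| ≤ Format.BFloat16.maxRat) :
    |(roundNE Format.BFloat16 (SumTree.eval (flα Format.Binary32) T)).toRat - ∑ j, ∑ i, a j i * b j i|
      ≤ (35 / 289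
          + (((k : ℚ) - 1) / 16777217 + ((B : ℚ) - 1) / 16777217 * (1 + ((k : ℚ) - 1) / 16777217))
            * (324 / 289)
          + 1 / 257 * (324 / 289) * (1 + (((k : ℚ) - 1) / 16777217
            + ((B : ℚ) - 1) / 16777217 * (1 + ((k : ℚ) - 1) / 16777217))))
        * ∑ j, ∑ i, |a j i * b j i| := by
  have hacc := abs_twoLevel_sub_exact_le (α := Format.Binary32) (β := Format.Binary32)
    (by decide) (by decide) ts T k hT hinner hK houter
  rw [hexact, habs, hlen, Binary32_sharp_unit] at hacc
  have hk' : (1 : ℚ) ≤ k := by exact_mod_cast hk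
  have hB' : (1 : ℚ) ≤ B := by exact_mod_cast hB
  have hγ0 : (0 : ℚ) ≤ ((k : ℚ) - 1) * (1 / 16777217)
      + ((B : ℚ) - 1) * (1 / 16777217) * (1 + ((k : ℚ) - 1) * (1 / 16777217)) := by
    have h1 : (0 : ℚ) ≤ (k : ℚ) - 1 := by linarith
    have h2 : (0 : ℚ) ≤ (B : ℚ) - 1 := by linarith
    positivity
  have h := gemm_mxCeil_E4M3_output a b hγ0 hκ hca hcb hacc Format.BFloat16 hlo hhi
  rw [BFloat16_sharp_unit] at h
  refine le_trans h (le_of_eq ?_)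
  ring

end Summit.Ventures.CertifiedArithmetic.LowPrec.GemmEnvelope
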